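import Summits.QuantumFields.YangMills.Theorems.BalabanUVNodesN18Beta0LimitOfKernelLetters
import Literature.MathematicalPhysics.QuantumFieldTheory.Balaban1983to89.Beta.RemainderChain

/-!
# BalabanUVNodes ∕ N18 — THE REMAINDER BAND AT THE FACE: node U2's history moduli WITH FADING MEMORY make the one-loop remainder `β¹ = β_m − β⁰`
# UNIFORMLY SMALL ON THE WINDOW, `|β_m k p − β⁰_k| ≤ C·γ∕(1 − θ)` for every `p ∈ ]0, γ]^{k+1}` — i.e. the β sub-cell's `RemainderConst` letter for the record's
# DEFINITIONAL one-loop split, from N22's kernel NE9 ∧ fading memory + (D4)'s (5.10) clause (N18's own NE5 idle)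
# (Track A, DAG node N18 = NE5, cluster K4 «SpineRates»; key K3⁷ `SpineGivenEndpointR13SepCoPH`, skeleton v5 941dddb108cbaacf)

Cell `pub-ymgap` (HUMAN RULING D-0062), WIDTH SEAT `pub-ymgap-dag-n18-w1` generation 3, FILE 3 (sequel of `…N18Beta0LimitOfKernelLetters`, p606904).  THEOREMS ONLY
(0 `def`, 0 `instance`, 0 `notation`, 0 `sorry`; standard axioms); filed `--kind proof --supports stmt-QuantumFields-20544 --as helper`.  COUNT-NEUTRAL.

HONEST FRAMING (binding).  A LOCATED junction: one elementary estimate (a telescoped Lipschitz sum with geometric weights, then the face limit of file 1) composed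
BY NAME with landed producers — dag-n22-w3's `histLipschitz_betaMerged_of_ne9` ∕ `fadingMemory_histModuli_of_fadingMemory`, dag-n17-w3's
`histLipschitz_of_readOutAt_n22`, the β sub-cell's letter `Beta.RemainderChain.RemainderConst`, def-B's `oneLoopSplit_betaOfMerged`.  The kernel letters (NE9 with
fading-memory moduli, the (5.10) clause — N22's ∕ (D4)'s content, UNPRINTED for d = 4) and the admissibility `hadm` of the reference histories STAY DISPLAYED.
The band obtained is `O(γ)` (what a Lipschitz modulus gives), NOT print's `O(ε₁)` chain bound (`Beta.RemainderChain.Chain.abs_beta1_le`) and NOT `O(g_k²)`; it is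
asserted for nothing of Bałaban's.  N17 ∕ N18 ∕ N22 NOT discharged; K3⁷ OPEN (`stub_rates13H` NOT proved); K0⁷ ∕ K2⁷ served by name only, no stub proved or
claimed; counts UNMOVED (typed 28∕28 · discharged 5∕27 (A 5∕28); the chair's single count line is the only count).  One finite four-torus programme at fixed ε —
R4 closes the CONDITIONAL rung `BalabanLadder.UV` only; NOTHING about the continuum limit, ℝ⁴, OS axioms, infinite volume or the Yang–Mills mass gap (Clay) is
proved or claimed by any of this.

WHY.  The β of record is the DEFINITIONAL one-loop split `betaOfRecord₁₃ = betaOfMerged β_m β⁰ θ.γ`, `β⁰ := beta0OfMerged β_m θ.v₀` (def-B `Node00/BetaOfRecord`;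
`oneLoopSplit_betaOfMerged β_m β⁰ γ` has `β1 k = 𝟙_{]0,γ]^{k+1}}·(β_m k − β⁰_k)`).  The K0⁷ ∕ N28 ∕ β-sub-cell roads read the remainder through the CONSTANT-FORM letter
`RemainderConst S γ r : ∀ k p ∈ ]0,γ]^{k+1}, |S.β1 k p| ≤ r` ((AF-1w); e.g. `RCUD`'s `betaUpperH_of_band_const`, ym-nodeO P3's (SBC) road «band on β⁰ ∧ `RemainderConst`
⟹ the 3ᴬ box», which there carries `Beta0LimitExists` as a hypothesis — discharged by file 1).  Node U2's input pair — `HistLipschitz Λ γ β_m` with `FadingMemory C θ Λ`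
(`0 ≤ Λ k i ≤ C θ^{k−i}`) — gives, for `p ∈ ]0,γ]^{k+1}` and the reference fibre `update (v₀ k) last g`, `|β_m k p − β_m k (…g)| ≤ Σ_i Λ k i·γ ≤ C·γ·Σ_{j≤k} θ^j ≤ C·γ∕(1−θ)`,
uniformly in `g`; letting `g → 0⁺` (file 1: the limit IS `β⁰_k`) yields the band `|β_m k p − β⁰_k| ≤ C·γ∕(1−θ)`, UNIFORM IN `k`.  Both inputs are PRODUCED in the tree from
N22's kernel letters + the (5.10) clause (dag-n22-w3) ∕ from `ReadOutAt D u ∧ N22At u` (dag-n17-w3 + dag-n22-w3's fading-memory transfer).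

WHAT (theorems only).
* §1 node U2 currency (ANY `HBeta`): `abs_sub_le_of_mem_Ioc` (two members of `]0,γ]` are `γ`-close) · `sum_moduli_le_of_fadingMemory` (`Σ_{i ≤ k} Λ k i ≤ C∕(1−θ)`) ·
  `abs_sub_update_last_le_sum_of_histLipschitz` · ★ `abs_sub_beta0OfMerged_le_band_of_histLipschitz_fadingMemory` (the BAND) ·
  ★★ `remainderConst_betaOfMerged_of_histLipschitz_fadingMemory` (`RemainderConst (oneLoopSplit_betaOfMerged β_m (beta0OfMerged β_m v₀) γ) γ (C·γ·(1−θ)⁻¹)`).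
* §2 generic term family (def-W1's kernel objects): ★ `remainderConst_betaMerged_of_ne9_fadingMemory` (`0 < κ`, `NE9 (EA F ℰ ρ bV) (Window γ) κ Λ`, node U3's
  `FadingMemory C₉ ω Λ`, `0 ≤ ω < 1`, `KernelDecay … 0 1 κ`, admissible `v₀`; band constant `betaPrime510 4 1 κ · C₉ · ω · γ ∕ (1 − ω)`).
* §3 AT THE RECORD, Stage 13, letter-block edition: ★★ `remainderConst_record_of_kernelNE9_letters` (`ℓ.Signs`, `0 < ℓ.κ`, K3⁷ v5 §2b (i)∕(iii)'s `h9`∕`hdec` VERBATIM at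
  `(ℓ.κ, ℓ.moduli)`, `hadm` ⟹ `RemainderConst` for THE RECORD's split of `betaOfRecord₁₃ F N θ` with `r = betaPrime510 4 1 ℓ.κ · ℓ.C₉ · ℓ.ω · θ.γ ∕ (1 − ℓ.ω)`).
* §4 K4 currency: ★★ `abs_βfun_sub_beta0OfMerged_le_band_of_readOutAt_n22` (`ReadOutAt D u ∧ N22At u ∧ u.ω < 1`, admissible `v₀` ⟹ the band for `D.βfun` with
  `r = u.cr·u.C₉·u.ω·u.γ∕(1−u.ω)`) and `remainderConst_record_of_readOutAt_n22_rateCarriersOfRecord₁₃CoPH` (at the bundle of record of any `𝔯`: the record's split).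

References (locators only): [I] = [Balaban1987RG1] T. Bałaban, Commun. Math. Phys. **109** (1987): (1.20)–(1.22) p. 264, (2.12)–(2.14) p. 268, §5 p. 298, (5.10) p. 293,
Thm 2 p. 259 (the (AF-1w) reading of the β sub-cell).
-/

noncomputable section

open Filter Topology
open scoped BigOperators

namespace YMDAG.N18.RemainderBandOfKernelLetters

open Literature.MathematicalPhysics.QuantumFieldTheory.Balaban1983to89
open Literature.MathematicalPhysics.QuantumFieldTheory.Balaban1983to89.T4Continuum (T4Family ULoop)
open Literature.MathematicalPhysics.QuantumFieldTheory.Balaban1983to89.T4OutputRate (Window NE9)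
open Literature.MathematicalPhysics.QuantumFieldTheory.Balaban1983to89.FlowStep (Box HBeta mem_box histBox_eq_box)
open Literature.MathematicalPhysics.QuantumFieldTheory.Balaban1983to89.T4CouplingMatching (HistLipschitz FadingMemory)
open Literature.MathematicalPhysics.QuantumFieldTheory.Balaban1983to89.Beta.RemainderChain (RemainderConst)
open Literature.MathematicalPhysics.QuantumFieldTheory.Balaban1983to89.Node00 (TermFamily1 betaMerged betaOfMerged beta0OfMerged Beta0LimitExists
  tendsto_beta0OfMerged oneLoopSplit_betaOfMerged mergedTermFamilyMatT TcanOfRecord chiβOfRecord₁₃ betaOfRecord₁₃ Stage13Params Stage13HParams U3Letters₁₁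
  datumOfRecord₁₃CoPH)
open Literature.MathematicalPhysics.QuantumFieldTheory.Balaban1983to89.Node00.U3OfKernels (EA objectsOfRecord₁₃ KernelDecay KernelDecayOfRecord₁₃)
open Literature.MathematicalPhysics.QuantumFieldTheory.Balaban1983to89.B12Sec2to5 (betaPrime510)
open YMDAG.UVSplit (U3Carriers N22At ReadOutAt Datum RateReading₁₃CoPH rateCarriersOfRecord₁₃CoPH)
open YMDAG.N22.AtKernels (histLipschitz_betaMerged_of_ne9 fadingMemory_histModuli_of_fadingMemory)
open YMDAG.N17.HistModuliCont (histLipschitz_of_readOutAt_n22)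
open YMDAG.N18.Beta0LimitOfKernelLetters (update_last_mem_box beta0LimitExists_of_histLipschitz)

/-! ## §1 Node U2 currency: history moduli with fading memory ⇒ the remainder band at the face -/

section U2

variable {β : HBeta} {Λ : ℕ → ℕ → ℝ} {γ C θ : ℝ}

/-- Two members of `]0, γ]` are `γ`-close. [folklore] -/
theorem abs_sub_le_of_mem_Ioc {x y : ℝ} (hx : x ∈ Set.Ioc 0 γ) (hy : y ∈ Set.Ioc 0 γ) : |x - y| ≤ γ := by
  rw [abs_sub_le_iff]
  constructor <;> linarith [hx.1, hx.2, hy.1, hy.2]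

/-- **THE TOTAL MODULUS UNDER FADING MEMORY**: `0 ≤ Λ k i ≤ C θ^{k−i}` (`0 ≤ θ < 1`) gives `Σ_{i ≤ k} Λ k i ≤ C∕(1 − θ)`, UNIFORMLY IN `k`
(reflect the index, then the geometric series). [folklore] -/
theorem sum_moduli_le_of_fadingMemory (hΛ : FadingMemory C θ Λ) (hθ0 : 0 ≤ θ) (hθ1 : θ < 1) (k : ℕ) :
    ∑ i : Fin (k + 1), Λ k i ≤ C * (1 - θ)⁻¹ := by
  have hC : 0 ≤ C := by
    have h00 := hΛ 0 0 le_rfl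
    simpa using h00.1.trans h00.2
  have step : ∑ i : Fin (k + 1), Λ k i ≤ ∑ i : Fin (k + 1), C * θ ^ (k - i) :=
    Finset.sum_le_sum fun i _ => (hΛ k i (Nat.le_of_lt_succ i.isLt)).2
  have hrange : ∑ i : Fin (k + 1), C * θ ^ (k - (i : ℕ)) = C * ∑ i ∈ Finset.range (k + 1), θ ^ (k - i) := by
    rw [Finset.mul_sum]
    exact Fin.sum_univ_eq_sum_range (fun i => C * θ ^ (k - i)) (k + 1)
  have hrefl : ∑ i ∈ Finset.range (k + 1), θ ^ (k - i) = ∑ m ∈ Finset.range (k + 1), θ ^ m := by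
    rw [← Finset.sum_range_reflect (fun m => θ ^ m) (k + 1)]
    refine Finset.sum_congr rfl fun i _ => ?_
    rw [show k + 1 - 1 - (i : ℕ) = k - i by omega]
  have htail : ∑ m ∈ Finset.range (k + 1), θ ^ m ≤ (1 - θ)⁻¹ :=
    sum_le_hasSum _ (fun n _ => pow_nonneg hθ0 n) (hasSum_geometric_of_lt_one hθ0 hθ1)
  calc ∑ i : Fin (k + 1), Λ k i ≤ ∑ i : Fin (k + 1), C * θ ^ (k - (i : ℕ)) := step
    _ = C * ∑ m ∈ Finset.range (k + 1), θ ^ m := by rw [hrange, hrefl]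
    _ ≤ C * (1 - θ)⁻¹ := mul_le_mul_of_nonneg_left htail hC

/-- **TELESCOPED LIPSCHITZ SUM ON THE BOX**: with NON-NEGATIVE moduli, two box histories are `γ·Σ_i Λ k i`-close in `β k`. [cite: Balaban1987RG1, §5 p.298 (the moduli are binders; bookkeeping)] -/
theorem abs_sub_le_sum_of_histLipschitz (hL : HistLipschitz Λ γ β) (hΛ0 : ∀ k i, i ≤ k → 0 ≤ Λ k i) {k : ℕ} {p q : Fin (k + 1) → ℝ}
    (hp : p ∈ Box γ k) (hq : q ∈ Box γ k) : |β k p - β k q| ≤ γ * ∑ i : Fin (k + 1), Λ k i := by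
  refine (hL k p q hp hq).trans ?_
  rw [Finset.mul_sum]
  refine Finset.sum_le_sum fun i _ => ?_
  rw [mul_comm γ]
  exact mul_le_mul_of_nonneg_left (abs_sub_le_of_mem_Ioc ((mem_box.1 hp) i) ((mem_box.1 hq) i)) (hΛ0 k i (Nat.le_of_lt_succ i.isLt))

/-- ★ **THE REMAINDER BAND AT THE FACE**: `HistLipschitz Λ γ β` with `FadingMemory C θ Λ` (`0 ≤ θ < 1`) and admissible reference histories give, for EVERY `k` and EVERY
`p ∈ ]0, γ]^{k+1}`, `|β k p − beta0OfMerged β v₀ k| ≤ C·γ·(1 − θ)⁻¹` — compare `p` with the reference fibre `update (v₀ k) last g` (bound uniform in `g`), then let `g → 0⁺`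
(file 1: the one-sided limit exists and IS `beta0OfMerged`). [cite: Balaban1987RG1, (2.12)-(2.14) p.268 and §5 p.298] -/
theorem abs_sub_beta0OfMerged_le_band_of_histLipschitz_fadingMemory (hL : HistLipschitz Λ γ β) (hΛ : FadingMemory C θ Λ) (hθ0 : 0 ≤ θ) (hθ1 : θ < 1)
    {v₀ : (k : ℕ) → (Fin (k + 1) → ℝ)} (hadm : ∀ k i, 0 < v₀ k i ∧ v₀ k i ≤ γ) (k : ℕ) {p : Fin (k + 1) → ℝ} (hp : p ∈ Box γ k) :
    |β k p - beta0OfMerged β v₀ k| ≤ C * γ * (1 - θ)⁻¹ := by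
  have hγ : 0 < γ := (hadm k (Fin.last k)).1.trans_le (hadm k (Fin.last k)).2
  have hΛ0 : ∀ k i, i ≤ k → 0 ≤ Λ k i := fun k i hik => (hΛ k i hik).1
  have ht := tendsto_beta0OfMerged β v₀ (beta0LimitExists_of_histLipschitz hL hadm) k
  have hB : γ * ∑ i : Fin (k + 1), Λ k i ≤ C * γ * (1 - θ)⁻¹ := by
    calc γ * ∑ i : Fin (k + 1), Λ k i ≤ γ * (C * (1 - θ)⁻¹) := mul_le_mul_of_nonneg_left (sum_moduli_le_of_fadingMemory hΛ hθ0 hθ1 k) hγ.le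
      _ = C * γ * (1 - θ)⁻¹ := by ring
  have hev : ∀ᶠ g in 𝓝[>] (0 : ℝ), |β k p - β k (Function.update (v₀ k) (Fin.last k) g)| ≤ C * γ * (1 - θ)⁻¹ := by
    filter_upwards [Ioc_mem_nhdsGT hγ] with g hg
    exact (abs_sub_le_sum_of_histLipschitz hL hΛ0 hp (update_last_mem_box (mem_box.2 (hadm k)) hg)).trans hB
  have h1 : Tendsto (fun g : ℝ => |β k p - β k (Function.update (v₀ k) (Fin.last k) g)|) (𝓝[>] (0 : ℝ))
      (𝓝 |β k p - beta0OfMerged β v₀ k|) := (tendsto_const_nhds.sub ht).abs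
  exact le_of_tendsto h1 hev

/-- ★★ **THE β SUB-CELL's `RemainderConst` LETTER FOR THE DEFINITIONAL ONE-LOOP SPLIT** `oneLoopSplit_betaOfMerged β (beta0OfMerged β v₀) γ` of def-B's β of record shape
(`β1 k = 𝟙_{]0,γ]^{k+1}}·(β k − β⁰_k)`): `HistLipschitz Λ γ β ∧ FadingMemory C θ Λ` (`0 ≤ θ < 1`) at admissible `v₀` ⟹ `RemainderConst … γ (C·γ·(1−θ)⁻¹)`.  An `O(γ)` band —
NOT print's `O(ε₁)` chain bound (`Chain.abs_beta1_le`), which it does not replace. [cite: Balaban1987RG1, Thm 2 p.259 and (2.12)-(2.14) p.268] -/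
theorem remainderConst_betaOfMerged_of_histLipschitz_fadingMemory (hL : HistLipschitz Λ γ β) (hΛ : FadingMemory C θ Λ) (hθ0 : 0 ≤ θ) (hθ1 : θ < 1)
    {v₀ : (k : ℕ) → (Fin (k + 1) → ℝ)} (hadm : ∀ k i, 0 < v₀ k i ∧ v₀ k i ≤ γ) :
    RemainderConst (oneLoopSplit_betaOfMerged β (beta0OfMerged β v₀) γ) γ (C * γ * (1 - θ)⁻¹) := by
  intro k p hp
  rw [histBox_eq_box] at hp
  show |(Box γ k).indicator (fun w => β k w - beta0OfMerged β v₀ k) p| ≤ _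
  rw [Set.indicator_of_mem hp]
  exact abs_sub_beta0OfMerged_le_band_of_histLipschitz_fadingMemory hL hΛ hθ0 hθ1 hadm k hp

end U2

/-! ## §2 Generic term family at def-W1's kernel objects: kernel NE9 ∧ node U3's fading memory + one (5.10) clause ⇒ the band (N18 idle) -/

section Kernels

variable {𝔄 : Type*} [NormedRing 𝔄] [NormedAlgebra ℝ 𝔄]
variable {V : Type*} [NormedAddCommGroup V] [NormedSpace ℝ V] {ι : Type*} [Fintype ι]
variable (F : T4Family) (ℰ : TermFamily1 F 𝔄) (ρ : V →L[ℝ] 𝔄) (bV : Module.Basis ι ℝ V)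

/-- `0 ≤ betaPrime510 4 1 κ` (a `tsum` of non-negative terms; dag-n22-w3's inline step, named here). [folklore] -/
theorem betaPrime510_four_one_nonneg (κ : ℝ) : 0 ≤ betaPrime510 4 1 κ := by
  unfold betaPrime510
  rw [one_mul]
  exact tsum_nonneg fun x => mul_nonneg (sq_nonneg _) (Real.exp_nonneg _)

/-- ★ **THE REMAINDER BAND FOR THE MERGED β OF A TERM FAMILY FROM N22's KERNEL LETTERS + ONE (5.10) CLAUSE**: `0 < κ`, `NE9 (EA F ℰ ρ bV) (Window γ) κ Λ`, node U3's
`FadingMemory C₉ ω Λ` with `0 ≤ ω < 1`, `KernelDecay F ℰ ρ bV (Window γ) 0 1 κ`, admissible `v₀` ⟹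
`RemainderConst (oneLoopSplit_betaOfMerged β_m (beta0OfMerged β_m v₀) γ) γ (betaPrime510 4 1 κ · C₉ · ω · γ · (1 − ω)⁻¹)`, `β_m := betaMerged F ℰ ρ bV`
(node U2's moduli `betaPrime510 4 1 κ · Λ (k+1) i` inherit fading memory `(β′·C₉·ω, ω)` — dag-n22-w3).  LOCATED: every input displayed. [cite: Balaban1987RG1, (1.20)-(1.22) p.264, §5 p.298 and (5.10) p.293] -/
theorem remainderConst_betaMerged_of_ne9_fadingMemory {γ κ C₉ ω : ℝ} {Λ : ℕ → ℕ → ℝ} (hκ : 0 < κ) (h9 : NE9 (EA F ℰ ρ bV) (Window γ) κ Λ)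
    (hΛ : T4OutputRate.FadingMemory C₉ ω Λ) (hω0 : 0 ≤ ω) (hω1 : ω < 1) (hdec : KernelDecay F ℰ ρ bV (Window γ) 0 1 κ)
    {v₀ : (k : ℕ) → (Fin (k + 1) → ℝ)} (hadm : ∀ k i, 0 < v₀ k i ∧ v₀ k i ≤ γ) :
    RemainderConst (oneLoopSplit_betaOfMerged (betaMerged F ℰ ρ bV) (beta0OfMerged (betaMerged F ℰ ρ bV) v₀) γ) γ
      (betaPrime510 4 1 κ * C₉ * ω * γ * (1 - ω)⁻¹) :=
  remainderConst_betaOfMerged_of_histLipschitz_fadingMemory (histLipschitz_betaMerged_of_ne9 F ℰ ρ bV hκ h9 hdec)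
    (fadingMemory_histModuli_of_fadingMemory (betaPrime510_four_one_nonneg κ) hΛ) hω0 hω1 hadm

end Kernels

/-! ## §3 At the record, Stage 13: the `RemainderConst` letter for THE RECORD's one-loop split from the letter block's kernel inputs -/

section Record

open scoped Matrix.Norms.L2Operator

variable (F : T4Family) (N : ℕ) [NeZero N]

/-- ★★ **`RemainderConst` FOR THE RECORD's DEFINITIONAL SPLIT OF `betaOfRecord₁₃ F N θ`** (`= betaOfMerged β_m (beta0OfMerged β_m θ.v₀) θ.γ` by `rfl`, β_m the merged β of
record): from `ℓ.Signs` (`0 ≤ ℓ.ω < 1`, `ℓ.moduli k i = ℓ.C₉·ℓ.ω^{k−i} ≥ 0`), `0 < ℓ.κ`, kernel NE9 of the functional of record at `(ℓ.κ, ℓ.moduli)` and the (5.10) clause of record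
at `ℓ.κ` (VERBATIM K3⁷ v5 §2b (i)∕(iii)'s `h9`∕`hdec`) and admissible `θ.v₀`:
`RemainderConst (oneLoopSplit_betaOfMerged β_m (beta0OfMerged β_m θ.v₀) θ.γ) θ.γ (betaPrime510 4 1 ℓ.κ · ℓ.C₉ · ℓ.ω · θ.γ · (1 − ℓ.ω)⁻¹)`.  LOCATED; `O(θ.γ)`, not `O(ε₁)`.
[cite: Balaban1987RG1, Thm 2 p.259, (2.12)-(2.14) p.268, §5 p.298 and (5.10) p.293] -/
theorem remainderConst_record_of_kernelNE9_letters (θ : Stage13Params F N) (ℓ : U3Letters₁₁) (hs : ℓ.Signs) (hκ : 0 < ℓ.κ)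
    (h9 : NE9 ((objectsOfRecord₁₃ F N θ ℓ).EA 0) (Window θ.γ) ℓ.κ ℓ.moduli) (hdec : KernelDecayOfRecord₁₃ F N θ 0 1 ℓ.κ)
    (hadm : ∀ k i, 0 < θ.v₀ k i ∧ θ.v₀ k i ≤ θ.γ) :
    letI := θ.instVβ₁; letI := θ.instVβ₂; letI := θ.instιβ
    RemainderConst
      (oneLoopSplit_betaOfMerged (betaMerged F (mergedTermFamilyMatT F N (TcanOfRecord F N) (chiβOfRecord₁₃ F N θ) θ.εbg) θ.ρ8 θ.bV)
        (beta0OfMerged (betaMerged F (mergedTermFamilyMatT F N (TcanOfRecord F N) (chiβOfRecord₁₃ F N θ) θ.εbg) θ.ρ8 θ.bV) θ.v₀) θ.γ)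
      θ.γ (betaPrime510 4 1 ℓ.κ * ℓ.C₉ * ℓ.ω * θ.γ * (1 - ℓ.ω)⁻¹) := by
  letI := θ.instVβ₁; letI := θ.instVβ₂; letI := θ.instιβ
  exact remainderConst_betaMerged_of_ne9_fadingMemory F _ θ.ρ8 θ.bV hκ h9 (fun a i _ => ⟨hs.moduli_nonneg a i, le_rfl⟩)
    hs.ω_nonneg hs.ω_lt_one hdec hadm

/-- **THE BAND, POINTWISE, AT THE RECORD** (same inputs): for every `k` and every `p ∈ ]0, θ.γ]^{k+1}`,
`|β_m k p − beta0OfMerged β_m θ.v₀ k| ≤ betaPrime510 4 1 ℓ.κ · ℓ.C₉ · ℓ.ω · θ.γ · (1 − ℓ.ω)⁻¹`. [cite: Balaban1987RG1, (2.12)-(2.14) p.268 and §5 p.298] -/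
theorem abs_betaMerged_sub_beta0OfMerged_record_le_band_of_kernelNE9_letters (θ : Stage13Params F N) (ℓ : U3Letters₁₁) (hs : ℓ.Signs)
    (hκ : 0 < ℓ.κ) (h9 : NE9 ((objectsOfRecord₁₃ F N θ ℓ).EA 0) (Window θ.γ) ℓ.κ ℓ.moduli) (hdec : KernelDecayOfRecord₁₃ F N θ 0 1 ℓ.κ)
    (hadm : ∀ k i, 0 < θ.v₀ k i ∧ θ.v₀ k i ≤ θ.γ) (k : ℕ) {p : Fin (k + 1) → ℝ} (hp : p ∈ Box θ.γ k) :
    letI := θ.instVβ₁; letI := θ.instVβ₂; letI := θ.instιβ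
    |betaMerged F (mergedTermFamilyMatT F N (TcanOfRecord F N) (chiβOfRecord₁₃ F N θ) θ.εbg) θ.ρ8 θ.bV k p -
        beta0OfMerged (betaMerged F (mergedTermFamilyMatT F N (TcanOfRecord F N) (chiβOfRecord₁₃ F N θ) θ.εbg) θ.ρ8 θ.bV) θ.v₀ k| ≤
      betaPrime510 4 1 ℓ.κ * ℓ.C₉ * ℓ.ω * θ.γ * (1 - ℓ.ω)⁻¹ := by
  letI := θ.instVβ₁; letI := θ.instVβ₂; letI := θ.instιβ
  exact abs_sub_beta0OfMerged_le_band_of_histLipschitz_fadingMemory (histLipschitz_betaMerged_of_ne9 F _ θ.ρ8 θ.bV hκ h9 hdec)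
    (fadingMemory_histModuli_of_fadingMemory (betaPrime510_four_one_nonneg ℓ.κ) (fun a i _ => ⟨hs.moduli_nonneg a i, le_rfl⟩))
    hs.ω_nonneg hs.ω_lt_one hadm k hp

end Record

/-! ## §4 K4 currency: `ReadOutAt D u ∧ N22At u ∧ u.ω < 1` ⇒ the band for the datum's β (N18 idle); at the bundle of record, the record's split -/

section Carriers

open scoped Matrix.Norms.L2Operator

variable {N : ℕ} [NeZero N] {F : T4Family}

/-- ★★ **THE REMAINDER BAND FOR THE DATUM's β ⇐ (D4) ∧ N22 — N18 IDLE**: from `ReadOutAt D u` (window clause, run A's `RepresentsA`, slice membership, the read-out bound,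
`0 ≤ u.cr`, `0 ≤ u.ω`), `N22At u` (NE9 ∧ node U3's fading memory of `u.Λ`) and `u.ω < 1`, at admissible `v₀`: for every `k` and `p ∈ ]0, u.γ]^{k+1}`,
`|D.βfun k p − beta0OfMerged D.βfun v₀ k| ≤ u.cr·u.C₉·u.ω·u.γ·(1 − u.ω)⁻¹` (dag-n17-w3's moduli `u.cr·u.Λ (k+1) i` with dag-n22-w3's inherited fading memory).  LOCATED.
[cite: Balaban1987RG1, (2.12)-(2.14) p.268 and §5 p.298] -/
theorem abs_βfun_sub_beta0OfMerged_le_band_of_readOutAt_n22 (D : Datum F N) {u : U3Carriers} (hD4 : ReadOutAt D u) (h22 : N22At u) (hω : u.ω < 1)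
    {v₀ : (k : ℕ) → (Fin (k + 1) → ℝ)} (hadm : ∀ k i, 0 < v₀ k i ∧ v₀ k i ≤ u.γ) (k : ℕ) {p : Fin (k + 1) → ℝ} (hp : p ∈ Box u.γ k) :
    |D.βfun k p - beta0OfMerged D.βfun v₀ k| ≤ u.cr * u.C₉ * u.ω * u.γ * (1 - u.ω)⁻¹ := by
  have hcr : 0 ≤ u.cr := by
    obtain ⟨_, _, _, _, _, _, _, _, _, _, _, hcr, _, _, _, _, _⟩ := hD4
    exact hcr
  have hω0 : 0 ≤ u.ω := by
    obtain ⟨_, _, _, _, _, _, _, _, _, _, _, _, _, _, hω0, _, _⟩ := hD4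
    exact hω0
  exact abs_sub_beta0OfMerged_le_band_of_histLipschitz_fadingMemory (histLipschitz_of_readOutAt_n22 D hD4 h22)
    (fadingMemory_histModuli_of_fadingMemory hcr h22.2) hω0 hω hadm k hp

/-- **`RemainderConst` FOR THE DATUM's β OF RECORD SHAPE from (D4) ∧ N22**: the definitional split `oneLoopSplit_betaOfMerged D.βfun (beta0OfMerged D.βfun v₀) u.γ` carries
`RemainderConst … u.γ (u.cr·u.C₉·u.ω·u.γ·(1−u.ω)⁻¹)` (on the box the split's `β1` is `D.βfun − β⁰`). [cite: Balaban1987RG1, Thm 2 p.259 and (2.12)-(2.14) p.268] -/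
theorem remainderConst_βfun_of_readOutAt_n22 (D : Datum F N) {u : U3Carriers} (hD4 : ReadOutAt D u) (h22 : N22At u) (hω : u.ω < 1)
    {v₀ : (k : ℕ) → (Fin (k + 1) → ℝ)} (hadm : ∀ k i, 0 < v₀ k i ∧ v₀ k i ≤ u.γ) :
    RemainderConst (oneLoopSplit_betaOfMerged D.βfun (beta0OfMerged D.βfun v₀) u.γ) u.γ (u.cr * u.C₉ * u.ω * u.γ * (1 - u.ω)⁻¹) := by
  intro k p hp
  rw [histBox_eq_box] at hp
  show |(Box u.γ k).indicator (fun w => D.βfun k w - beta0OfMerged D.βfun v₀ k) p| ≤ _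
  rw [Set.indicator_of_mem hp]
  exact abs_βfun_sub_beta0OfMerged_le_band_of_readOutAt_n22 D hD4 h22 hω hadm k hp

/-- ★★ **AT THE BUNDLE OF RECORD OF ANY STAGE-13 RATE READING** (K3⁷ v5's `rrOfRecord 𝔯 ksel` at one tuple and run length; window radius `θ.γ`, `rfl`; the datum's β IS
`betaOfRecord₁₃ F N θ'`, `rfl`, whose DEFINITIONAL split is `oneLoopSplit_betaOfMerged β_m (beta0OfMerged β_m θ.v₀) θ.γ` read through `betaOfRecord₁₃ = betaOfMerged β_m …`):
the N22 and (D4) conjuncts at `(rateCarriersOfRecord₁₃CoPH 𝔯 F θ hP g₀ os k).u3` with `ω < 1` there and admissible `θ.v₀` give the band for `betaOfRecord₁₃` pointwise on the boxes.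
LOCATED: the conjuncts are K3⁷'s, displayed; `stub_rates13H` NOT proved. [cite: Balaban1987RG1, (2.12)-(2.14) p.268 and §5 p.298] -/
theorem abs_betaOfRecord₁₃_sub_beta0OfMerged_le_band_of_readOutAt_n22_rateCarriersOfRecord₁₃CoPH (𝔯 : RateReading₁₃CoPH N) (θ : Stage13HParams F N)
    (hP : θ.Provisos₁₃CoPH F N) (g₀ : ℕ → ℝ) (os : List (ULoop F)) (k₀ : ℕ)
    (hD4 : ReadOutAt (datumOfRecord₁₃CoPH F N θ hP) (rateCarriersOfRecord₁₃CoPH 𝔯 F θ hP g₀ os k₀).u3)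
    (h22 : N22At (rateCarriersOfRecord₁₃CoPH 𝔯 F θ hP g₀ os k₀).u3) (hω : (rateCarriersOfRecord₁₃CoPH 𝔯 F θ hP g₀ os k₀).u3.ω < 1)
    (hadm : ∀ j i, 0 < θ.v₀ j i ∧ θ.v₀ j i ≤ θ.γ) (k : ℕ) {p : Fin (k + 1) → ℝ} (hp : p ∈ Box θ.γ k) :
    |betaOfRecord₁₃ F N θ.toStage13Params k p - beta0OfMerged (betaOfRecord₁₃ F N θ.toStage13Params) θ.v₀ k| ≤
      (rateCarriersOfRecord₁₃CoPH 𝔯 F θ hP g₀ os k₀).u3.cr * (rateCarriersOfRecord₁₃CoPH 𝔯 F θ hP g₀ os k₀).u3.C₉ *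
        (rateCarriersOfRecord₁₃CoPH 𝔯 F θ hP g₀ os k₀).u3.ω * θ.γ * (1 - (rateCarriersOfRecord₁₃CoPH 𝔯 F θ hP g₀ os k₀).u3.ω)⁻¹ :=
  abs_βfun_sub_beta0OfMerged_le_band_of_readOutAt_n22 (datumOfRecord₁₃CoPH F N θ hP) hD4 h22 hω (v₀ := θ.v₀) hadm k hp

end Carriers

end YMDAG.N18.RemainderBandOfKernelLetters

end
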